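import Mathlib
import Summits.BirchSwinnertonDyer.BirchSwinnertonDyer.Theorems.ManinLocalTwoThreeDegreeCoprimeSixLValue
import HarnessLib

/-!
# `N = 4p`, lattice-optimal, `3 ∤ deg φ`: `v₃(L(W,1)/Ω⁺_f) = −1` exactly

Summit `BirchSwinnertonDyer`, sub-problem `BirchSwinnertonDyer`, route `ManinLocalTwoThree`; width seat `bsd-line-manin23-p2`
(gen 9), `--supports` the crux C2 `ManinOddAtFour` (stmt-BirchSwinnertonDyer-22967).  The 3-adic part of
`ManinLocalTwoThreeDegreeCoprimeSixLValue` WITHOUT the parity hypothesis: at `N = 4p` (`p` an odd prime), for a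
lattice-optimal datum (`Λ_W = c·Λ_f`) of modular degree prime to `3`, `2·{∞,0}_f ∉ Λ_f`
(`two_mul_cuspZeroSymbol_not_mem_of_not_three_dvd`) excludes `3 ∣ k` in `6·[0]⁺_f = k` (`Δ_W < 0`) resp.
`12·[0]⁺_f = k` (`Δ_W > 0`); since `6·#π₀·[0]⁺_f ∈ ℤ` always, `v₃(L(W,1)/Ω⁺_f) = −1` in both cases.

PROVED here (no `sorry`): **`six_mul_ratPlusSymbol_zero_not_three_dvd_of_Δ_neg`**,
**`twelve_mul_ratPlusSymbol_zero_not_three_dvd_of_Δ_pos`**.  BSD is not proved by this; Manin's conjecture is not proved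
by this.
-/

set_option autoImplicit false
set_option linter.dupNamespace false

noncomputable section

open scoped MatrixGroups ModularForm
open CongruenceSubgroup
open Literature.NumberTheory.EllipticCurves Literature.NumberTheory.EllipticCurves.ModularForms

namespace Summit.BirchSwinnertonDyer.BirchSwinnertonDyer.Theorems.ManinLocalTwoThree

/-- **`3 ∤ deg`, `Δ_W < 0`, lattice-optimal, `N = 4p` ⟹ `6·L(W,1)/Ω⁺_f = k ∈ ℤ` with `3 ∤ k`.** -/
theorem six_mul_ratPlusSymbol_zero_not_three_dvd_of_Δ_neg {W : WeierstrassCurve ℚ} [W.IsElliptic] {p : ℕ}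
    [NeZero (4 * p)] (hp : p.Prime) (hp2 : p ≠ 2) (D : ModularParametrizationData W (4 * p)) (hΔ : W.Δ < 0)
    (hopt : ∀ z ∈ D.L.lattice, ∃ w ∈ periodLattice D.f, z = D.c * w) (h3 : ¬ 3 ∣ D.deg) :
    ∃ k : ℤ, ¬ (3 : ℤ) ∣ k ∧ 6 * ratPlusSymbol D.f 0 = k := by
  obtain ⟨k, hk6⟩ := exists_six_mul_ratPlusSymbol_zero_eq_of_Δ_neg hp hp2 D hΔ hopt
  refine ⟨k, fun ⟨j, hj⟩ =>
    not_exists_two_mul_ratPlusSymbol_zero_eq_int_of_not_three_dvd hp hp2 D h3 ⟨j, ?_⟩, hk6⟩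
  have : (6 : ℚ) * ratPlusSymbol D.f 0 = 3 * (j : ℚ) := by rw [hk6, hj]; push_cast; ring
  linarith

/-- **`3 ∤ deg`, `Δ_W > 0`, lattice-optimal, `N = 4p` ⟹ `12·L(W,1)/Ω⁺_f = k ∈ ℤ` with `3 ∤ k`**
(`3 ∣ k` would put `c·2{∞,0}_f = ±(k/3)·Ω₀` in `Λ_W = c·Λ_f`). -/
theorem twelve_mul_ratPlusSymbol_zero_not_three_dvd_of_Δ_pos {W : WeierstrassCurve ℚ} [W.IsElliptic] {p : ℕ}
    [NeZero (4 * p)] (hp : p.Prime) (hp2 : p ≠ 2) (D : ModularParametrizationData W (4 * p)) (hΔ : 0 < W.Δ)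
    (hopt : ∀ z ∈ D.L.lattice, ∃ w ∈ periodLattice D.f, z = D.c * w) (h3 : ¬ 3 ∣ D.deg) :
    ∃ k : ℤ, ¬ (3 : ℤ) ∣ k ∧ 12 * ratPlusSymbol D.f 0 = k := by
  obtain ⟨k, hk12⟩ := exists_twelve_mul_ratPlusSymbol_zero_eq hp hp2 D
  refine ⟨k, ?_, hk12⟩
  rintro ⟨j, rfl⟩
  have hj : 4 * ratPlusSymbol D.f 0 = j := by push_cast at hk12; linarith
  apply two_mul_cuspZeroSymbol_not_mem_of_not_three_dvd hp hp2 D h3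
  have hc : (D.c : ℝ) ≠ 0 := Int.cast_ne_zero.mpr D.maninConstant_ne_zero_holds
  have hΩ₀ : (((D.L.minRealPeriod : ℝ)) : ℂ) ∈ D.L.lattice := D.isReal_neronLattice.minRealPeriod_mem_lattice
  have h2Ω₀ := minRealPeriod_eq_of_Δ_pos D hΔ hopt
  obtain ⟨s, -, hsc⟩ : ∃ s : ℤ, (s = 1 ∨ s = -1) ∧ (D.c : ℝ) = s * |(D.c : ℝ)| := by
    rcases lt_or_gt_of_ne hc with hneg | hpos
    · exact ⟨-1, Or.inr rfl, by rw [abs_of_neg hneg]; push_cast; ring⟩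
    · exact ⟨1, Or.inl rfl, by rw [abs_of_pos hpos]; push_cast; ring⟩
  have hmem : (D.c : ℂ) * ((2 : ℂ) * modularSymbol D.f 0) ∈ D.L.lattice := by
    have hz := D.L.lattice.smul_mem (s * j : ℤ) hΩ₀
    convert hz using 1
    rw [modularSymbol_zero_eq_ratPlusSymbol_mul_plusPeriod D, zsmul_eq_mul]
    have hj' : (((4 * ratPlusSymbol D.f 0 : ℚ) : ℝ) : ℂ) = (((j : ℚ) : ℝ) : ℂ) := by rw [hj]
    have hΩ₀' : ((D.L.minRealPeriod : ℝ) : ℂ) = ((|(D.c : ℝ)| * plusPeriod D.f / 2 : ℝ) : ℂ) := by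
      rw [← h2Ω₀]; push_cast; ring
    have hsc' : (((D.c : ℝ)) : ℂ) = (((s : ℝ) * |(D.c : ℝ)| : ℝ) : ℂ) := by rw [← hsc]
    rw [hΩ₀']
    push_cast at hj' hsc' ⊢
    linear_combination ((s : ℂ) * ((|(D.c : ℝ)| : ℝ) : ℂ) * (plusPeriod D.f : ℂ) / 2) * hj' +
      (2 * ((ratPlusSymbol D.f 0 : ℚ) : ℂ) * (plusPeriod D.f : ℂ)) * hsc'
  obtain ⟨w, hw, hcw⟩ := hopt _ hmem
  have hc' : (D.c : ℂ) ≠ 0 := Int.cast_ne_zero.mpr D.maninConstant_ne_zero_holds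
  rwa [mul_left_cancel₀ hc' hcw]

end Summit.BirchSwinnertonDyer.BirchSwinnertonDyer.Theorems.ManinLocalTwoThree

end
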